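import Summits.HodgeConjecture.HodgeConjecture.Theorems.F0P6aIsomSchemeFiniteType   -- ★ p850061 twin of ED. 2 fc3ee9cc3230dc0c (namespace KEPT ⇒ every FQN unchanged)
import HarnessLib

/-! # F0_P6a_IsomSchemeFiniteType — ED. 3 = SHIM (rung-0 re-home; LEAD «M-72» (4) ∕ «M-78» CLASS III, «K3» sweep; dealer «L7» LA7-plan (g4))

Every declaration of ED. 2 (sha16 fc3ee9cc3230dc0c, 262 l., sorry-free: `TupleIsoVia`, `TupleIsoAt₂`, `GraphLetters`, `prodEmb`,
`stub_ILET`, `stub_ICON`, `isomPieces_finiteType_of_line`) now lives, byte for byte and under the SAME namespace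
`Summit.HodgeConjecture.HodgeConjecture.Cruxes.HLiu418.F0P6aIsomSchemeFiniteType`, in ★ `Theorems/F0P6aIsomSchemeFiniteType.lean`
(p850061; RE-HOME TABLE v1.3.1 row 19).  This module keeps its name so that its importers (`rg` 09:0xZ: `F0_P6a_StubKOTT`,
`F0_P6a_PELInputs`) and by-name readers resolve unchanged through the import above; it declares nothing.  Edition history ED. 1–2
stays in the line card and in git; future changes are ★-side proposals on the `Theorems/` file.  HC_CM is proved only modulo the
7 printed citations (2 remaining named inputs: hLiu418 = stmt-HodgeConjecture-24832, h413 = stmt-HodgeConjecture-24833) until rung 0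
closes; count-neutral (0 `sorry`, 0 socket, 0 declaration). -/
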